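import Literature.MathematicalPhysics.QuantumFieldTheory.Balaban1983to89.B9Thm314GpFlatMultiLevelTorus
import Literature.MathematicalPhysics.QuantumFieldTheory.Balaban1983to89.B6Ineq268MultiLevelTorus

/-!
# `Balaban1983to89.B9Thm314GpSqFlatMultiLevelTorus` — [B9] THEOREM 3.14 (pp. 426–427, (3.154)) AT `U = 1` FOR `G′²` AND
FOR THE (2.69)-KERNEL OF `Q′G′²Q′*` ON THE GENUINE `k`-LEVEL TORUS: for two nested families `{Ω_j}`, `{Ω′_j}` on one
torus `T_η` and top blocks `y, y′` of `Ω = Ω_k ∩ Ω′_k`, the difference `G′[Ω]² − G′[Ω′]²` obeys the sup bound with weight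
`(L^kη)⁴` and the difference of the kernels `X[Ω](y, y′) − X[Ω′](y, y′)` of `Q′G′²Q′*` obeys [4] (2.68), both «with the
additional factor exp(−δ₀d(y, y′, Ω))» — file 1 of the `(Q′G′²Q′*)⁻¹` instance of Theorem 3.14 of seat p21 (no existing
module is touched; no fact is minted)

FRAMING (verbatim cell line):
statement-level skeleton of published theorems with citation tags; proofs where landed; nothing here is a claim about the Yang–Mills mass gap

Sources under audit (cell pub-balaban / lit-balaban): T. Bałaban, *Propagators for lattice gauge theories in a
background field*, Commun. Math. Phys. **99** (1985) 389–434 [`Balaban1985BackgroundPropagators`, "B9"], pp. 426–427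
[PDF 38–39] (Theorem 3.14, (3.154)) and p. 398 [PDF 10] (Theorem 3.2, (3.48)) — held text
`paper:balaban1985-cmp99-background-propagators` p0038/p0039/p0010 and page scans `1985-cmp99-background-propagators-p038`,
`-p010` read this generation; T. Bałaban, *Propagators and renormalization transformations for lattice gauge theories. II*,
Commun. Math. Phys. **96** (1984) 223–250 [`Balaban1984PropagatorsII`, "[4]"], (2.68)–(2.69) p. 235 [PDF 13], (2.67) p. 234,
(2.60)–(2.61) p. 234, (2.52)–(2.55) p. 232.  Unit `lit-balaban-p21` (Phase-2 proof seat p21 gen 19, HOME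
`run/shared/lean/pub/lit-balaban/`, free-target protocol G.5-34(d); B9 fold owner r06, B6 fold owner r03, referee ref-4).

## WHAT IS PRINTED (quotations AS PRINTED; «…» marks our elisions)

B9 p. 426 (scan p038): «Let us assume that we have two sequences of domains {Ω_j}, {Ω′_j}, both satisfying the conditions
(2.1)–(2.4) in [4], with M and R sufficiently large, so that all the conditions needed in this paper are satisfied. We
construct operators for both sequences and we define Ω = Ω_k ∩ Ω′_k. Let us take localizations determined by points
y, y′ ∈ Ω^{(k)} (i.e. these are cubes Δ̃(y), Δ̃(y′) in the case of operators G′, G, G₁, 𝔊, the cube Δ̃(y) and the point y′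
in the case of H, H₁, and the points y, y′ in the case of (Q′G′²Q′*)⁻¹, (QGQ*)⁻¹, etc.). We have **Theorem 3.14.** If we
take a pair of operators constructed for the two sequences {Ω_j}, {Ω′_j}, then their difference satisfies all the
inequalities characteristic for operators of the considered type, with the additional factor exp(−δ₀d(y, y′, Ω)),
d(y, y′, Ω) = inf_{y₁∈Ωᶜ∩T^{(k)}} (|y − y₁| + |y₁ − y′|) (3.154) on the right-hand sides.» (p. 427) «We take random walk
expansions for both operators, and in the difference all terms for walks with localizations contained in Ω are cancelled.
… Then the exponential factor in (3.108) gives the factor (3.154) (after adjusting a definition of δ₀).»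
[4] p. 235 (2.68): «|(Q′G′²Q′*)(y, y′)| = |Σ_{y″∈𝔅}(Q′G′Δ(y″)G′Q′*)(y, y′)| ≤ … ≤ O(1)(L^jη)⁴(L^{j′}η)^{−d}e^{−¼δ₀d(y,y′)},
(2.68) where we have used the inequalities (2.60), (2.63) of Lemma 1.»

## WHAT THIS FILE CERTIFIES (kernel-checked; lattice units `η = 1`; setting of `B9Thm314GpFlatTorusGeometry`)

For the genuine `k`-level torus operators `G′[D] = gmlT … D.lev a` of two families `D, D′ : TDomains` on ONE torus
(`Ω₁ = Ω′₁ = T_η`, levels `1 … k`), `Ω = Ω_k ∩ Ω′_k` read on `k`-blocks, `d(y, y′, Ω)` = (3.154) (`dOmega` of the geometry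
file), `d_D`, `d_{D′}` the two multiscale distances (2.46) (`geomT`):
* §1 `scaleSum_GpGp`, **`hasMajorant_GpGp`** — the scale sum of (2.68) at the level of block majorants: if `G′` has the
  (2.67)₁ majorant `C·L^{2j}·e^{−δd_T}` then `G′·G′` has the majorant `C²L²c·L^{4j}·e^{−½δd_T}` ((2.52)–(2.55) «preserved
  under the composition» + `B6Ineq268.scaleSum_le` on the torus chain geometry: the weight `L^{2(j″−j)}` absorbed by (2.60)
  through a quarter of the rate under `L² ≤ e^{¼δ(R·L·M_h − 1)}`, a quarter summed by (2.61) at `¼δ`, the halves joined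
  by (2.54));
* §2 `gpSq_sub_gpSq` — `G′[D]² − G′[D′]² = G′[D]·G′[D]·(Δ′[D′]−Δ′[D])·G′[D′] + G′[D]·(Δ′[D′]−Δ′[D])·G′[D′]·G′[D′]` (the
  resolvent identity of the geometry file, twice); **`gpSq_engine`** — the trivial two-term bound
  (`B9Thm314GpFlatMultiLevelTorus.trivial_bound` with the §1 majorants of both families: the characteristic factor with
  `min(d_D, d_{D′})`), the resolvent estimate of EACH of the two terms (`B9Thm314GpFlatResolvent.resolvent_bound` with the
  outer factors `(A_L, A_R) = (G′[D], 1)`, inner exponent `m = 2`, and `(1, G′[D′])`, `m = 4`: the factor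
  `e^{−¼δd(y,y′,Ω)}`), and `min(P²F, Q²F) ≤ PQF` (`combined_bound`); **`thm314_GpSq_flat_multiLevelTorus`** — the packaged
  statement: `∃ δ C M₀ N₀`, for all admissible `k, M_h, R, P`, all `D, D′`, windowed weights, common top blocks `y ∋ x`,
  `y′ ⊃ supp λ`, `|λ| ≤ B`: `|((G′[D]² − G′[D′]²)λ)(x)| ≤ C·L^{4k}·e^{−δ·min(d_D,d_{D′})(y,y′)}·e^{−δ·d(y,y′,Ω)}·B`
  (inputs BY NAME: the torus (2.67)₁ `B6Prop22MultiLevelTorus.prop22_first_multiLevelTorus` for both families,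
  `consts_260_261` at the rates `δ` and `½δ`, `weights_repair`);
* §3 `W_mul_XkT_eq` (`(L^{j′})^{d+1}·X(y, y′) = Σ_x q(y, x)·((G′G′)1_{B(y′)})(x)`), `indicator_common`, `qB_common`,
  `W_common`, `W_mul_XkT_sub` (on COMMON blocks the block data of the two families coincide, so the weighted kernel
  difference is the `Q′`-average of `(G′[D]² − G′[D′]²)1_{B(y′)}`), and **`thm314_X_flat_multiLevelTorus`**: for common top
  blocks `y, y′`, `|(L^k)^{d+1}(X[D] − X[D′])(y, y′)| ≤ C·L^{4k}·e^{−δ·min(d_D,d_{D′})(y,y′)}·e^{−δ·d(y,y′,Ω)}` and the (2.68)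
  shape `|(X[D] − X[D′])(y, y′)| ≤ C·L^{4k}·((L^k)^{d+1})⁻¹·e^{−δ·min(…)}·e^{−δ·d(y,y′,Ω)}` — the input of the companion file
  `B9Thm314QGGQInvFlatMultiLevelTorus` (Theorem 3.14 for `(Q′G′²Q′*)⁻¹`, characteristic inequality (3.48) = [4] (2.87)).

## HONEST SCOPE

* `U = 1` only (no background field), torus lineage of this seat (`Ω₁ = T_η`, levels `1 … k`, `A = 0`, `m² = 0`, lattice
  units `(L^jη)⁴(L^{j′}η)^{−d} ↦ L^{4j}·((L^{j′})^{d+1})⁻¹`, spatial dimension `d + 1`, `P_μ ≥ 4`).  `G′²` and the kernel of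
  `Q′G′²Q′*` are INTERMEDIATE objects of print (the (2.68) step towards Proposition 2.3 / B9 Theorem 3.2); B9 lists
  `(Q′G′²Q′*)⁻¹`, not `Q′G′²Q′*`, among the operators of Theorem 3.14 — the inverse is the companion file's subject, this
  file is its input.  Only COMMON TOP blocks `y, y′` («the points y, y′ ∈ Ω^{(k)}»); the characteristic factor carries
  `min(d_D, d_{D′})` (two families, two distances (2.46)); (3.154) as in the geometry file (`k`-block centres, torus
  sup-distance in units of `L^k`, `inf ∅ := 0`).
* ROUTE (declared): print's walk-expansion cancellation is replaced by the resolvent identity (geometry file) applied to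
  each factor of `G′² − G′′² = G′(G′ − G′′) + (G′ − G′′)G′′`; the resolvent estimate is the generic one of
  `B9Thm314GpFlatResolvent` (outer factors `G′[D]` resp. `G′[D′]`, whose block majorants are §1).  Constants: with `C₀, δ₀`
  the constant and rate of the torus (2.67)₁, `δ = ½δ₀`, `c₁`/`c₂` the (2.61)-constants of the torus at `¼δ`/`⅛δ`,
  `K = C₀²L²c₁`, `A = max(a₊, a₋)`: `C = √(2K)·√(8C₀KAL²e^{¾δ}c₂) + 1`, output rate `⅛δ`; thresholds `M₀` of (2.67)₁ and
  `N₀` = max of that of (2.67)₁ and the two `consts_260_261` thresholds — all `k`-uniform, independent of `D, D′`.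
* Nothing is inferred from the manuscript: every step is kernel-checked; the quoted sentences locate the statements.
-/

namespace Literature.MathematicalPhysics.QuantumFieldTheory.Balaban1983to89.B9Thm314GpSqFlatMultiLevelTorus

open Finset Matrix
open Literature.MathematicalPhysics.QuantumFieldTheory.Balaban1983to89.B4Reflection242 (boxDom)
open Literature.MathematicalPhysics.QuantumFieldTheory.Balaban1983to89.B6MultiLevelBoxOperator
open Literature.MathematicalPhysics.QuantumFieldTheory.Balaban1983to89.B6MultiLevelTorusOperator
open Literature.MathematicalPhysics.QuantumFieldTheory.Balaban1983to89.B6Geom246MultiLevelBox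
open Literature.MathematicalPhysics.QuantumFieldTheory.Balaban1983to89.B6Geom246MultiLevelTorus
open Literature.MathematicalPhysics.QuantumFieldTheory.Balaban1983to89.B8Ineq192MultiLevelTorus (geomTB geomTB_dist
  geomTB_L geomTB_RM geomTB_RM_nonneg levelSepTB lenT_eq symmT symmTB triangleTB XkT W_eq_lenT_pow lenT_pos kerOp_XkT)
open Literature.MathematicalPhysics.QuantumFieldTheory.Balaban1983to89.B6RandomWalk (HasMajorant BlockSupp
  hasMajorant_mono hasMajorant_mul)
open Literature.MathematicalPhysics.QuantumFieldTheory.Balaban1983to89.B6Lemma21Repaired (Ineq261With)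
open Literature.MathematicalPhysics.QuantumFieldTheory.Balaban1983to89.B6Ineq268 (ratio mx scaleSum_le)
open Literature.MathematicalPhysics.QuantumFieldTheory.Balaban1983to89.B6Ineq243TwoLevelBox (aNext)
open Literature.MathematicalPhysics.QuantumFieldTheory.Balaban1983to89.B9Thm314GpFlatTorusGeometry
open Literature.MathematicalPhysics.QuantumFieldTheory.Balaban1983to89.B9Thm314GpFlatResolvent
open Literature.MathematicalPhysics.QuantumFieldTheory.Balaban1983to89.B9Thm314GpFlatMultiLevelTorus
open Literature.MathematicalPhysics.QuantumFieldTheory.Balaban1983to89.B6Ineq268MultiLevelBox (W W_pos W_eq qB QB QsB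
  qB_ne_zero sum_abs_qB_le QsB_apply)
open Literature.MathematicalPhysics.QuantumFieldTheory.Balaban1983to89.B6Prop22MultiLevelTorus (prop22_first_multiLevelTorus)
open Literature.MathematicalPhysics.QuantumFieldTheory.Balaban1983to89.B6Ineq2142 (kernelW avgOp_apply)
open Literature.MathematicalPhysics.QuantumFieldTheory.Balaban1983to89.B6Prop23Chain (mat)

noncomputable section

variable {d : ℕ}

/-! ## §1 The block majorant of `G′·G′` on the torus: (2.67)₁ twice, (2.60), (2.61) -/

section GpGp

variable {ℓ Mh k R : ℕ} {P : Fin (d + 1) → ℕ} (D : TDomains d ℓ Mh k P R)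

/-- **THE SCALE SUM OF (2.68) AT BLOCK-MAJORANT LEVEL**: `Σ_{y″} C L^{2j} e^{−δd(y,y″)}·C L^{2j″} e^{−δd(y″,y′)}
≤ C²L²c·L^{4j}·e^{−½δd(y,y′)}` on the torus — the weight `L^{2(j″−j)}` absorbed by (2.60) through a quarter of the first
rate, a quarter of the second summed by (2.61), the remaining halves joined by (2.54) (`B6Ineq268.scaleSum_le` on the torus
chain geometry `geomTB`). [cite: Balaban1984PropagatorsII, (2.68) p.235 («where we have used the inequalities (2.60), (2.63) of Lemma 1»), (2.60)–(2.61) p.234] -/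
theorem scaleSum_GpGp (hMh : 1 ≤ Mh) (hP : ∀ μ, 1 ≤ P μ) (hRM : 1 ≤ R * ((ℓ + 1) * Mh)) {C δ c : ℝ}
    (hδ : 0 ≤ δ) (h261 : Ineq261With c (geomT D) δ (1 / 4))
    (hthr : ((ℓ : ℝ) + 1) ^ 2 ≤ Real.exp (1 / 4 * δ * ((R : ℝ) * (((ℓ : ℝ) + 1) * Mh) - 1)))
    (y y' : ↥(bset D.toDomains)) :
    ∑ y'' : ↥(bset D.toDomains), (C * ((ℓ : ℝ) + 1) ^ (2 * y.1.1) * Real.exp (-(δ * (geomT D).dist y y'')))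
        * (C * ((ℓ : ℝ) + 1) ^ (2 * y''.1.1) * Real.exp (-(δ * (geomT D).dist y'' y')))
      ≤ C ^ 2 * (((ℓ : ℝ) + 1) ^ 2 * c) * ((ℓ : ℝ) + 1) ^ (4 * y.1.1) * Real.exp (-(δ / 2 * (geomT D).dist y y')) := by
  have hL1 : (1 : ℝ) ≤ (ℓ : ℝ) + 1 := by linarith [(Nat.cast_nonneg ℓ : (0 : ℝ) ≤ ℓ)]
  have hL0 : (0 : ℝ) < (ℓ : ℝ) + 1 := by positivity
  have hd0 : ∀ s t : ↥(bset D.toDomains), 0 ≤ (geomT D).dist s t := (triangle_refl_nonneg_T D hMh hP).2.2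
  have htri := triangleTB D hMh hP
  have hsymm := symmTB D
  have hsep := levelSepTB D hMh hP hRM
  have hRMnn := geomTB_RM_nonneg D hMh hRM
  have h261B : Ineq261With c (geomTB D) δ (1 / 4) := fun z => h261 z
  have hthrB : (geomTB D).L ^ 2 ≤ Real.exp ((0 + 1 / 4) * δ * (geomTB D).R * (geomTB D).M) := by
    rw [show (0 + 1 / 4) * δ * (geomTB D).R * (geomTB D).M = 1 / 4 * δ * ((geomTB D).R * (geomTB D).M) by ring,
      geomTB_RM D hMh, geomTB_L]
    exact hthr
  have hS := scaleSum_le (g := geomTB D) htri hsymm hsep (by rw [geomTB_L]; exact hL1) hRMnn (δ₀ := δ) (τ := 0)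
    (ρ := 1 / 2) (σ₁ := 1 / 4) (σ₂ := 1 / 4) hδ le_rfl (by norm_num) (by norm_num) h261B hthrB y y'
  rw [geomTB_L, geomTB_dist] at hS
  -- rewrite the summand: `L^{2j}·L^{2j″} = L^{4j}·ratio(y, y″)` and weaken the rates `δ ↦ ¾δ`
  have hpt : ∀ y'' : ↥(bset D.toDomains),
      (C * ((ℓ : ℝ) + 1) ^ (2 * y.1.1) * Real.exp (-(δ * (geomT D).dist y y'')))
        * (C * ((ℓ : ℝ) + 1) ^ (2 * y''.1.1) * Real.exp (-(δ * (geomT D).dist y'' y')))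
      ≤ C ^ 2 * ((ℓ : ℝ) + 1) ^ (4 * y.1.1) *
        (Real.exp (-(0 * δ * (geomTB D).R * (geomTB D).M * mx (geomTB D) y y'')) * ratio (geomTB D) y y''
          * Real.exp (-((1 / 2 + 1 / 4) * δ * (geomT D).dist y y''))
          * Real.exp (-((1 / 2 + 1 / 4) * δ * (geomT D).dist y'' y'))) := by
    intro y''
    have hr : ((ℓ : ℝ) + 1) ^ (2 * y.1.1) * ((ℓ : ℝ) + 1) ^ (2 * y''.1.1)
        = ((ℓ : ℝ) + 1) ^ (4 * y.1.1) * ratio (geomTB D) y y'' := by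
      unfold ratio
      rw [geomTB_L]
      show ((ℓ : ℝ) + 1) ^ (2 * y.1.1) * ((ℓ : ℝ) + 1) ^ (2 * y''.1.1)
        = ((ℓ : ℝ) + 1) ^ (4 * y.1.1) * (((ℓ : ℝ) + 1) ^ (2 * y''.1.1) / ((ℓ : ℝ) + 1) ^ (2 * y.1.1))
      have h2 : ((ℓ : ℝ) + 1) ^ (2 * y.1.1) ≠ 0 := by positivity
      rw [show 4 * y.1.1 = 2 * y.1.1 + 2 * y.1.1 by ring, pow_add]
      field_simp
    have h0 : Real.exp (-(0 * δ * (geomTB D).R * (geomTB D).M * mx (geomTB D) y y'')) = 1 := by simp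
    have he1 : Real.exp (-(δ * (geomT D).dist y y'')) ≤ Real.exp (-((1 / 2 + 1 / 4) * δ * (geomT D).dist y y'')) :=
      Real.exp_le_exp.2 (by nlinarith [hd0 y y'', hδ])
    have he2 : Real.exp (-(δ * (geomT D).dist y'' y')) ≤ Real.exp (-((1 / 2 + 1 / 4) * δ * (geomT D).dist y'' y')) :=
      Real.exp_le_exp.2 (by nlinarith [hd0 y'' y', hδ])
    have hrat0 : 0 ≤ ratio (geomTB D) y y'' := B6Ineq268.ratio_nonneg (g := geomTB D) (by rw [geomTB_L]; exact hL0.le) y y''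
    rw [h0, one_mul]
    calc (C * ((ℓ : ℝ) + 1) ^ (2 * y.1.1) * Real.exp (-(δ * (geomT D).dist y y'')))
          * (C * ((ℓ : ℝ) + 1) ^ (2 * y''.1.1) * Real.exp (-(δ * (geomT D).dist y'' y')))
        = C ^ 2 * (((ℓ : ℝ) + 1) ^ (2 * y.1.1) * ((ℓ : ℝ) + 1) ^ (2 * y''.1.1))
          * (Real.exp (-(δ * (geomT D).dist y y'')) * Real.exp (-(δ * (geomT D).dist y'' y'))) := by ring
      _ ≤ C ^ 2 * (((ℓ : ℝ) + 1) ^ (4 * y.1.1) * ratio (geomTB D) y y'')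
          * (Real.exp (-((1 / 2 + 1 / 4) * δ * (geomT D).dist y y''))
            * Real.exp (-((1 / 2 + 1 / 4) * δ * (geomT D).dist y'' y'))) := by
          rw [hr]
          exact mul_le_mul_of_nonneg_left (mul_le_mul he1 he2 (Real.exp_pos _).le (Real.exp_pos _).le)
            (by positivity)
      _ = _ := by ring
  calc _ ≤ ∑ y'' : ↥(bset D.toDomains), C ^ 2 * ((ℓ : ℝ) + 1) ^ (4 * y.1.1) *
        (Real.exp (-(0 * δ * (geomTB D).R * (geomTB D).M * mx (geomTB D) y y'')) * ratio (geomTB D) y y''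
          * Real.exp (-((1 / 2 + 1 / 4) * δ * (geomT D).dist y y''))
          * Real.exp (-((1 / 2 + 1 / 4) * δ * (geomT D).dist y'' y'))) := Finset.sum_le_sum fun y'' _ => hpt y''
    _ = C ^ 2 * ((ℓ : ℝ) + 1) ^ (4 * y.1.1) *
        ∑ y'' : ↥(bset D.toDomains),
          (Real.exp (-(0 * δ * (geomTB D).R * (geomTB D).M * mx (geomTB D) y y'')) * ratio (geomTB D) y y''
            * Real.exp (-((1 / 2 + 1 / 4) * δ * (geomT D).dist y y''))
            * Real.exp (-((1 / 2 + 1 / 4) * δ * (geomT D).dist y'' y'))) := by rw [Finset.mul_sum]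
    _ ≤ C ^ 2 * ((ℓ : ℝ) + 1) ^ (4 * y.1.1) * (((ℓ : ℝ) + 1) ^ 2 * c * Real.exp (-(1 / 2 * δ * (geomT D).dist y y'))) :=
        mul_le_mul_of_nonneg_left hS (by positivity)
    _ = _ := by ring_nf

/-- **THE BLOCK MAJORANT OF `G′·G′`** on the torus: if `G′` has the (2.67)₁ majorant `C·L^{2j}·e^{−δd_T}`, then `G′G′` has
the majorant `C²L²c·L^{4j}·e^{−½δd_T}` («this property is preserved under the composition», [4] p. 232, with the scale
sum of (2.68)). [cite: Balaban1984PropagatorsII, (2.52)–(2.55) p.232, (2.68) p.235] -/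
theorem hasMajorant_GpGp (hMh : 1 ≤ Mh) (hP : ∀ μ, 1 ≤ P μ) (hRM : 1 ≤ R * ((ℓ + 1) * Mh))
    (G : Matrix ↥(boxDom (N0 ℓ Mh k P)) ↥(boxDom (N0 ℓ Mh k P)) ℝ) {C δ c : ℝ} (hC : 0 ≤ C) (hδ : 0 ≤ δ)
    (hG : HasMajorant (g := geomT D) (blkOf D.toDomains) (Matrix.toLin' G)
      (fun y y' => C * ((ℓ : ℝ) + 1) ^ (2 * y.1.1) * Real.exp (-(δ * (geomT D).dist y y'))))
    (h261 : Ineq261With c (geomT D) δ (1 / 4))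
    (hthr : ((ℓ : ℝ) + 1) ^ 2 ≤ Real.exp (1 / 4 * δ * ((R : ℝ) * (((ℓ : ℝ) + 1) * Mh) - 1))) :
    HasMajorant (g := geomT D) (blkOf D.toDomains) (Matrix.toLin' (G * G))
      (fun y y' => C ^ 2 * (((ℓ : ℝ) + 1) ^ 2 * c) * ((ℓ : ℝ) + 1) ^ (4 * y.1.1)
        * Real.exp (-(δ / 2 * (geomT D).dist y y'))) := by
  have hK0 : ∀ s t : ↥(bset D.toDomains),
      0 ≤ C * ((ℓ : ℝ) + 1) ^ (2 * s.1.1) * Real.exp (-(δ * (geomT D).dist s t)) := fun s t => by positivity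
  have hmul := hasMajorant_mul (g := geomT D) (blkOf D.toDomains) hG hG hK0
  have e : Matrix.toLin' (G * G) = Matrix.toLin' G * Matrix.toLin' G := by
    rw [Matrix.toLin'_mul]; rfl
  rw [e]
  exact hasMajorant_mono (g := geomT D) (blkOf D.toDomains) hmul
    fun y y' => scaleSum_GpGp D hMh hP hRM hδ h261 hthr y y'

end GpGp

/-! ## §2 Theorem 3.14 at `U = 1` for `G′²` on the genuine `k`-level torus: trivial bound, two resolvent terms, combination -/

section GpSq

variable {ℓ Mh k R : ℕ} {P : Fin (d + 1) → ℕ}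

/-- the algebra of the difference of squares through the resolvent identity of file 1:
`G′[D]² − G′[D′]² = G′[D]·G′[D]·(Δ′[D′]−Δ′[D])·G′[D′]·1 + 1·G′[D]·(Δ′[D′]−Δ′[D])·G′[D′]·G′[D′]`.
[cite: Balaban1985BackgroundPropagators, Thm 3.14 p.427; Balaban1984PropagatorsII, p.225] -/
theorem gpSq_sub_gpSq (D D' : TDomains d ℓ Mh k P R) (a : ℕ → ℝ) (hMh : 1 ≤ Mh) (hP : ∀ μ, 1 ≤ P μ)
    (ha : ∀ j, 1 ≤ j → 0 < a j) :
    gmlT (N0 ℓ Mh k P) ℓ k D.lev a * gmlT (N0 ℓ Mh k P) ℓ k D.lev a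
        - gmlT (N0 ℓ Mh k P) ℓ k D'.lev a * gmlT (N0 ℓ Mh k P) ℓ k D'.lev a
      = gmlT (N0 ℓ Mh k P) ℓ k D.lev a * gmlT (N0 ℓ Mh k P) ℓ k D.lev a * diffM D D' a
            * gmlT (N0 ℓ Mh k P) ℓ k D'.lev a * 1
        + 1 * gmlT (N0 ℓ Mh k P) ℓ k D.lev a * diffM D D' a * gmlT (N0 ℓ Mh k P) ℓ k D'.lev a
            * gmlT (N0 ℓ Mh k P) ℓ k D'.lev a := by
  set G := gmlT (N0 ℓ Mh k P) ℓ k D.lev a with hG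
  set G' := gmlT (N0 ℓ Mh k P) ℓ k D'.lev a with hG'
  have hE : G - G' = G * diffM D D' a * G' := gmlT_sub_gmlT D D' a hMh hP ha
  calc G * G - G' * G' = G * (G - G') + (G - G') * G' := by
        rw [Matrix.mul_sub, Matrix.sub_mul]; abel
    _ = G * (G * diffM D D' a * G') + (G * diffM D D' a * G') * G' := by rw [hE]
    _ = _ := by rw [Matrix.mul_one, Matrix.one_mul, ← Matrix.mul_assoc, ← Matrix.mul_assoc]

/-- **THE ENGINE FOR `G′²`**: from the (2.67)₁ majorants of `G′[D]`, `G′[D′]` at ONE rate `δ` (constant `C·L^{2j}`),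
weights `0 ≤ a_j ≤ a₊` positive at levels `≥ 1`, (2.61) at `¼δ` (constant `c`) and at `¼·½δ` (constant `c′`) on both
families and the two (2.60)-thresholds, for common top blocks `y ∋ x`, `y′ ⊃ supp λ`:
`|((G′[D]² − G′[D′]²)λ)(x)| ≤ √(2K)·√(8CKa₊L²e^{¾δ}c′)·L^{4k}·e^{−¼δ·min(d_D,d_{D′})(y,y′)}·e^{−⅛δ·d(y,y′,Ω)}·B`,
`K = C²L²c`. [cite: Balaban1985BackgroundPropagators, Thm 3.14 (3.154) pp.426–427; Balaban1984PropagatorsII, (2.68) p.235, (2.67) p.234] -/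
theorem gpSq_engine (D D' : TDomains d ℓ Mh k P R) (hMh : 1 ≤ Mh) (hP : ∀ μ, 1 ≤ P μ)
    (hRM : 1 ≤ R * ((ℓ + 1) * Mh)) {a : ℕ → ℝ} {aplus : ℝ} (ha0 : ∀ j, 0 ≤ a j) (hap : ∀ j, a j ≤ aplus)
    (ha1 : ∀ j, 1 ≤ j → 0 < a j) {C δ c c' : ℝ} (hC : 0 ≤ C) (hδ : 0 ≤ δ)
    (hG : HasMajorant (g := geomT D) (blkOf D.toDomains) (Matrix.toLin' (gmlT (N0 ℓ Mh k P) ℓ k D.lev a))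
      (fun y y' => C * ((ℓ : ℝ) + 1) ^ (2 * y.1.1) * Real.exp (-(δ * (geomT D).dist y y'))))
    (hG' : HasMajorant (g := geomT D') (blkOf D'.toDomains) (Matrix.toLin' (gmlT (N0 ℓ Mh k P) ℓ k D'.lev a))
      (fun y y' => C * ((ℓ : ℝ) + 1) ^ (2 * y.1.1) * Real.exp (-(δ * (geomT D').dist y y'))))
    (h261 : Ineq261With c (geomT D) δ (1 / 4)) (h261' : Ineq261With c (geomT D') δ (1 / 4))
    (hthr : ((ℓ : ℝ) + 1) ^ 2 ≤ Real.exp (1 / 4 * δ * ((R : ℝ) * (((ℓ : ℝ) + 1) * Mh) - 1)))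
    (h261h : Ineq261With c' (geomT D) (δ / 2) (1 / 4))
    (hthrh : ((ℓ : ℝ) + 1) ^ 2 ≤ Real.exp (1 / 4 * (δ / 2) * ((R : ℝ) * (((ℓ : ℝ) + 1) * Mh) - 1)))
    {p q : ℕ × (Fin (d + 1) → ℤ)} (hpD : p ∈ bset D.toDomains) (hpD' : p ∈ bset D'.toDomains)
    (hqD : q ∈ bset D.toDomains) (hqD' : q ∈ bset D'.toDomains) (hp : p.1 = k) (hq : q.1 = k)
    {μv : ↥(boxDom (N0 ℓ Mh k P)) → ℝ} {B : ℝ} (hμ : BlockSupp (g := geomT D) (blkOf D.toDomains) μv ⟨q, hqD⟩ B)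
    {x : ↥(boxDom (N0 ℓ Mh k P))} (hx : blkOf D.toDomains x = ⟨p, hpD⟩) :
    |((gmlT (N0 ℓ Mh k P) ℓ k D.lev a * gmlT (N0 ℓ Mh k P) ℓ k D.lev a
        - gmlT (N0 ℓ Mh k P) ℓ k D'.lev a * gmlT (N0 ℓ Mh k P) ℓ k D'.lev a) *ᵥ μv) x|
      ≤ Real.sqrt (2 * (C ^ 2 * (((ℓ : ℝ) + 1) ^ 2 * c)))
          * Real.sqrt (2 * (2 * C * (C ^ 2 * (((ℓ : ℝ) + 1) ^ 2 * c)) * aplus * ((ℓ : ℝ) + 1) ^ 2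
            * Real.exp (3 / 2 * (δ / 2)) * c'))
          * ((ℓ : ℝ) + 1) ^ (4 * k)
        * Real.exp (-(1 / 2 * (δ / 2) * min ((geomT D).dist ⟨p, hpD⟩ ⟨q, hqD⟩) ((geomT D').dist ⟨p, hpD'⟩ ⟨q, hqD'⟩)))
        * Real.exp (-(1 / 4 * (δ / 2) * dOmega D D' p.2 q.2)) * B := by
  have hB : 0 ≤ B := hμ.nonneg
  have hL0 : (0 : ℝ) < (ℓ : ℝ) + 1 := by positivity
  have hap0 : 0 ≤ aplus := (ha0 0).trans (hap 0)
  have hc'0 : 0 ≤ c' := le_trans (Finset.sum_nonneg fun b _ => (Real.exp_pos _).le) (h261h ⟨p, hpD⟩)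
  have hδh : 0 ≤ δ / 2 := by positivity
  set G := gmlT (N0 ℓ Mh k P) ℓ k D.lev a with hGdef
  set G₁ := gmlT (N0 ℓ Mh k P) ℓ k D'.lev a with hG₁def
  set KT : ℝ := C ^ 2 * (((ℓ : ℝ) + 1) ^ 2 * c) with hKT
  have hKT0 : 0 ≤ KT := by
    have hc0 : 0 ≤ c := le_trans (Finset.sum_nonneg fun b _ => (Real.exp_pos _).le) (h261 ⟨p, hpD⟩)
    rw [hKT]; positivity
  -- the majorants of the squares in both families (rate `½δ`)
  have hGG := hasMajorant_GpGp D hMh hP hRM G hC hδ hG h261 hthr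
  have hGG' := hasMajorant_GpGp D' hMh hP hRM G₁ hC hδ hG' h261' hthr
  -- (i) the trivial bound
  have htriv := trivial_bound D D' (G * G) (G₁ * G₁) (KT := fun pr => KT * ((ℓ : ℝ) + 1) ^ (4 * pr.1)) hδh
    (hasMajorant_of_eq D hGG fun y y' => by rw [hKT]) (hasMajorant_of_eq D' hGG' fun y y' => by rw [hKT])
    hpD hpD' hqD hqD' (by positivity) hμ hx
  -- (ii) the two resolvent terms at the rate `½δ`
  have hGh := hasMajorant_rate_mono D hMh hP (fun y => C * ((ℓ : ℝ) + 1) ^ (2 * y.1.1)) (fun y => by positivity)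
    (show δ / 2 ≤ δ by linarith) hG
  have hG'h := hasMajorant_rate_mono D' hMh hP (fun y => C * ((ℓ : ℝ) + 1) ^ (2 * y.1.1)) (fun y => by positivity)
    (show δ / 2 ≤ δ by linarith) hG'
  have hres1 := resolvent_bound D D' hMh hP hRM ha0 hap 2 G 1 (KL := fun y => KT * ((ℓ : ℝ) + 1) ^ (4 * y.1.1))
    (CR := C) hC hδh hGG (by rw [Matrix.mul_one]; exact hG'h) h261h hthrh (y := ⟨p, hpD⟩) hp (by positivity)
    (y' := ⟨q, hqD'⟩) hq (blockSupp_transfer D D' hqD hqD' hμ) hx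
  have hres2 := resolvent_bound D D' hMh hP hRM ha0 hap 4 1 G₁ (KL := fun y => C * ((ℓ : ℝ) + 1) ^ (2 * y.1.1))
    (CR := KT) hKT0 hδh (by rw [Matrix.one_mul]; exact hGh) hGG' h261h hthrh (y := ⟨p, hpD⟩) hp (by positivity)
    (y' := ⟨q, hqD'⟩) hq (blockSupp_transfer D D' hqD hqD' hμ) hx
  -- the resolvent bound of the sum
  have hident := gpSq_sub_gpSq D D' a hMh hP ha1
  rw [← hGdef, ← hG₁def] at hident
  have hpk : (⟨p, hpD⟩ : ↥(bset D.toDomains)).1.1 = k := hp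
  have hres : |((G * G - G₁ * G₁) *ᵥ μv) x|
      ≤ 2 * (2 * C * KT * aplus * ((ℓ : ℝ) + 1) ^ 2 * Real.exp (3 / 2 * (δ / 2)) * c')
        * (((ℓ : ℝ) + 1) ^ (4 * k) * B) * Real.exp (-(1 / 2 * (δ / 2) * dOmega D D' p.2 q.2)) := by
    rw [hident, Matrix.add_mulVec, Pi.add_apply]
    refine (abs_add_le _ _).trans ?_
    have e1 : KT * ((ℓ : ℝ) + 1) ^ (4 * (⟨p, hpD⟩ : ↥(bset D.toDomains)).1.1)
          * (2 * C * aplus * ((ℓ : ℝ) + 1) ^ 2 * Real.exp (3 / 2 * (δ / 2)) * c')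
          * (((ℓ : ℝ) + 1) ^ (2 * k) / ((ℓ : ℝ) + 1) ^ (2 * k))
          * Real.exp (-(1 / 2 * (δ / 2) * dOmega D D' p.2 q.2)) * B
        = (2 * C * KT * aplus * ((ℓ : ℝ) + 1) ^ 2 * Real.exp (3 / 2 * (δ / 2)) * c')
          * (((ℓ : ℝ) + 1) ^ (4 * k) * B) * Real.exp (-(1 / 2 * (δ / 2) * dOmega D D' p.2 q.2)) := by
      rw [hpk, div_self (by positivity : ((ℓ : ℝ) + 1) ^ (2 * k) ≠ 0)]; ring
    have e2 : C * ((ℓ : ℝ) + 1) ^ (2 * (⟨p, hpD⟩ : ↥(bset D.toDomains)).1.1)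
          * (2 * KT * aplus * ((ℓ : ℝ) + 1) ^ 2 * Real.exp (3 / 2 * (δ / 2)) * c')
          * (((ℓ : ℝ) + 1) ^ (4 * k) / ((ℓ : ℝ) + 1) ^ (2 * k))
          * Real.exp (-(1 / 2 * (δ / 2) * dOmega D D' p.2 q.2)) * B
        = (2 * C * KT * aplus * ((ℓ : ℝ) + 1) ^ 2 * Real.exp (3 / 2 * (δ / 2)) * c')
          * (((ℓ : ℝ) + 1) ^ (4 * k) * B) * Real.exp (-(1 / 2 * (δ / 2) * dOmega D D' p.2 q.2)) := by
      rw [hpk]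
      have h4 : ((ℓ : ℝ) + 1) ^ (4 * k) = ((ℓ : ℝ) + 1) ^ (2 * k) * ((ℓ : ℝ) + 1) ^ (2 * k) := by
        rw [← pow_add]; ring_nf
      rw [h4, mul_div_cancel_right₀ _ (by positivity : ((ℓ : ℝ) + 1) ^ (2 * k) ≠ 0)]; ring
    rw [e1] at hres1
    rw [e2] at hres2
    linarith
  -- (iii) combine
  have h1 : |((G * G - G₁ * G₁) *ᵥ μv) x| ≤ 2 * KT * (((ℓ : ℝ) + 1) ^ (4 * k) * B)
      * Real.exp (-(δ / 2 * min ((geomT D).dist ⟨p, hpD⟩ ⟨q, hqD⟩) ((geomT D').dist ⟨p, hpD'⟩ ⟨q, hqD'⟩))) := by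
    calc _ ≤ _ := htriv
      _ = _ := by rw [hp]; ring
  have h2 : |((G * G - G₁ * G₁) *ᵥ μv) x|
      ≤ 2 * (2 * C * KT * aplus * ((ℓ : ℝ) + 1) ^ 2 * Real.exp (3 / 2 * (δ / 2)) * c')
        * (((ℓ : ℝ) + 1) ^ (4 * k) * B) * Real.exp (-(1 / 2 * (δ / 2) * dOmega D D' p.2 q.2)) := hres
  have hcomb := combined_bound (by positivity) (by positivity) (by positivity) h1 h2
  calc _ ≤ _ := hcomb
    _ = _ := by rw [hKT]; ring

/-- **[B9] THEOREM 3.14 AT `U = 1` FOR `G′² = G′·G′` ON THE GENUINE `k`-LEVEL TORUS** (the operator behind the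
(2.69)-kernel `Q′G′²Q′*`): there are `δ, C, M₀ > 0`, `N₀ ≥ 1` (functions of `d`, `L` and the weight window) such that for
every `k`, `M_h ≥ 3` with `L·M_h ≥ M₀`, `R ≥ 2L` with `R·L·M_h ≥ N₀ + 1`, `P_μ ≥ 4`, every two nested families `D, D′` of
the torus, windowed weights, every two top blocks `y ∋ x`, `y′ ⊃ supp λ` of `Ω = Ω_k ∩ Ω′_k` and `|λ| ≤ B`:
`|((G′[D]² − G′[D′]²)λ)(x)| ≤ C·L^{4k}·e^{−δ·min(d_D, d_{D′})(y,y′)}·e^{−δ·d(y,y′,Ω)}·B`.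
[cite: Balaban1985BackgroundPropagators, Thm 3.14 (3.154) pp.426–427; Balaban1984PropagatorsII, (2.68) p.235, Prop. 2.2 (2.67) p.234] -/
theorem thm314_GpSq_flat_multiLevelTorus (d ℓ : ℕ) (hℓ : 1 ≤ ℓ) (aminus aplus a2minus a2plus : ℝ) (ha : 0 < aminus)
    (ha2 : 0 < a2minus) :
    ∃ δ C M₀ : ℝ, ∃ N₀ : ℕ, 0 < δ ∧ 0 < C ∧ 0 < M₀ ∧ 0 < N₀ ∧
      ∀ (k Mh R : ℕ), 3 ≤ Mh → M₀ ≤ ((ℓ : ℝ) + 1) * Mh → 2 * (ℓ + 1) ≤ R → N₀ + 1 ≤ R * ((ℓ + 1) * Mh) →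
      ∀ (P : Fin (d + 1) → ℕ) (hP : ∀ μ, 1 ≤ P μ) (hP4 : ∀ μ, 4 ≤ P μ) (D D' : TDomains d ℓ Mh k P R)
        (a c : ℕ → ℝ), (∀ i, 1 ≤ i → aminus ≤ a i ∧ a i ≤ aplus) → (∀ i, 1 ≤ i → a2minus ≤ c i ∧ c i ≤ a2plus) →
        (∀ i, 1 ≤ i → a (i + 1) = aNext ℓ (a i) (c i)) →
      ∀ (p q : ℕ × (Fin (d + 1) → ℤ)) (hpD : p ∈ bset D.toDomains) (hpD' : p ∈ bset D'.toDomains)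
        (hqD : q ∈ bset D.toDomains) (hqD' : q ∈ bset D'.toDomains), p.1 = k → q.1 = k →
      ∀ (lam : ↥(boxDom (N0 ℓ Mh k P)) → ℝ) (B : ℝ),
        BlockSupp (g := geomT D) (blkOf D.toDomains) lam ⟨q, hqD⟩ B →
      ∀ x : ↥(boxDom (N0 ℓ Mh k P)), blkOf D.toDomains x = ⟨p, hpD⟩ →
        |((gmlT (N0 ℓ Mh k P) ℓ k D.lev a * gmlT (N0 ℓ Mh k P) ℓ k D.lev a
            - gmlT (N0 ℓ Mh k P) ℓ k D'.lev a * gmlT (N0 ℓ Mh k P) ℓ k D'.lev a) *ᵥ lam) x|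
          ≤ C * ((ℓ : ℝ) + 1) ^ (4 * k)
              * Real.exp (-(δ * min ((geomT D).dist ⟨p, hpD⟩ ⟨q, hqD⟩) ((geomT D').dist ⟨p, hpD'⟩ ⟨q, hqD'⟩)))
              * Real.exp (-(δ * dOmega D D' p.2 q.2)) * B := by
  obtain ⟨δ₀, C₀, M₀, N₀, hδ₀, hC₀, hM₀, hN₀, hmaj⟩ := prop22_first_multiLevelTorus d ℓ hℓ aminus aplus a2minus a2plus ha ha2
  have hL0 : (0 : ℝ) < (ℓ : ℝ) + 1 := by positivity
  -- the common rate `δ = ½δ₀` of the (2.67)₁ majorant and the `k`-uniform (2.60)/(2.61) data at `δ` and `½δ`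
  obtain ⟨δ, hδ⟩ : ∃ δ : ℝ, δ = δ₀ / 2 := ⟨_, rfl⟩
  have hδpos : 0 < δ := by rw [hδ]; positivity
  obtain ⟨N₁, c₁, hN₁, hc₁0, hcon₁⟩ := consts_260_261 d ℓ hδpos
  obtain ⟨N₂, c₂, hN₂, hc₂0, hcon₂⟩ := consts_260_261 d ℓ (half_pos hδpos)
  have hap0 : 0 ≤ max aplus aminus := le_trans ha.le (le_max_right _ _)
  obtain ⟨KT, hKT⟩ : ∃ KT : ℝ, KT = C₀ ^ 2 * (((ℓ : ℝ) + 1) ^ 2 * c₁) := ⟨_, rfl⟩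
  have hKT0 : 0 ≤ KT := by rw [hKT]; positivity
  obtain ⟨KR, hKR⟩ : ∃ KR : ℝ,
      KR = 2 * (2 * C₀ * KT * max aplus aminus * ((ℓ : ℝ) + 1) ^ 2 * Real.exp (3 / 2 * (δ / 2)) * c₂) := ⟨_, rfl⟩
  have hKR0 : 0 ≤ KR := by rw [hKR]; positivity
  refine ⟨1 / 4 * (δ / 2), Real.sqrt (2 * KT) * Real.sqrt KR + 1, M₀, max N₀ (max N₁ N₂), by positivity, by positivity,
    hM₀, lt_of_lt_of_le hN₀ (le_max_left _ _), ?_⟩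
  intro k Mh R hMh hM hR hRM P hP hP4 D D' a c haw hcw hac p q hpD hpD' hqD hqD' hp hq lam B hlam x hx
  have hMh1 : 1 ≤ Mh := le_trans (by norm_num) hMh
  have hRM0 : N₀ + 1 ≤ R * ((ℓ + 1) * Mh) := le_trans (Nat.add_le_add_right (le_max_left _ _) 1) hRM
  have hRM1 : N₁ + 1 ≤ R * ((ℓ + 1) * Mh) :=
    le_trans (Nat.add_le_add_right ((le_max_left N₁ N₂).trans (le_max_right N₀ _)) 1) hRM
  have hRM2 : N₂ + 1 ≤ R * ((ℓ + 1) * Mh) :=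
    le_trans (Nat.add_le_add_right ((le_max_right N₁ N₂).trans (le_max_right N₀ _)) 1) hRM
  have hRMone : 1 ≤ R * ((ℓ + 1) * Mh) := le_trans (by omega) hRM1
  obtain ⟨hthr₁, h261₁⟩ := hcon₁ k Mh R P hMh1 hP hRM1
  obtain ⟨hthr₂, h261₂⟩ := hcon₂ k Mh R P hMh1 hP hRM2
  -- the weights with level `0` repaired
  obtain ⟨a', ha'0, ha'p, ha'1, ha'eq⟩ := weights_repair ha haw
  have hG := hmaj k Mh R hMh hM hR hRM0 P hP hP4 D a c haw hcw hac
  have hG' := hmaj k Mh R hMh hM hR hRM0 P hP hP4 D' a c haw hcw hac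
  rw [gmlT_congr D ha'eq] at hG
  rw [gmlT_congr D' ha'eq] at hG'
  rw [← hδ] at hG hG'
  have hmain := gpSq_engine D D' hMh1 hP hRMone ha'0 ha'p ha'1 hC₀.le hδpos.le hG hG' (h261₁ D) (h261₁ D') hthr₁
    (h261₂ D) hthr₂ hpD hpD' hqD hqD' hp hq hlam hx
  rw [← gmlT_congr D ha'eq, ← gmlT_congr D' ha'eq, ← hKT, ← hKR] at hmain
  -- constants
  have hB : 0 ≤ B := hlam.nonneg
  have hm0 : 0 ≤ min ((geomT D).dist ⟨p, hpD⟩ ⟨q, hqD⟩) ((geomT D').dist ⟨p, hpD'⟩ ⟨q, hqD'⟩) :=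
    le_min ((triangle_refl_nonneg_T D hMh1 hP).2.2 _ _) ((triangle_refl_nonneg_T D' hMh1 hP).2.2 _ _)
  have hw1 : Real.exp (-(1 / 2 * (δ / 2) * min ((geomT D).dist ⟨p, hpD⟩ ⟨q, hqD⟩) ((geomT D').dist ⟨p, hpD'⟩ ⟨q, hqD'⟩)))
      ≤ Real.exp (-(1 / 4 * (δ / 2) * min ((geomT D).dist ⟨p, hpD⟩ ⟨q, hqD⟩) ((geomT D').dist ⟨p, hpD'⟩ ⟨q, hqD'⟩))) :=
    Real.exp_le_exp.2 (by nlinarith)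
  have hsq : Real.sqrt (2 * KT) * Real.sqrt KR ≤ Real.sqrt (2 * KT) * Real.sqrt KR + 1 := by linarith
  calc _ ≤ _ := hmain
    _ ≤ (Real.sqrt (2 * KT) * Real.sqrt KR + 1) * ((ℓ : ℝ) + 1) ^ (4 * k)
          * Real.exp (-(1 / 4 * (δ / 2) * min ((geomT D).dist ⟨p, hpD⟩ ⟨q, hqD⟩) ((geomT D').dist ⟨p, hpD'⟩ ⟨q, hqD'⟩)))
          * Real.exp (-(1 / 4 * (δ / 2) * dOmega D D' p.2 q.2)) * B := by
        refine mul_le_mul_of_nonneg_right ?_ hB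
        refine mul_le_mul_of_nonneg_right ?_ (Real.exp_pos _).le
        exact mul_le_mul (mul_le_mul_of_nonneg_right hsq (by positivity)) hw1 (Real.exp_pos _).le (by positivity)
    _ = _ := by ring

end GpSq

/-! ## §3 The (2.69)-kernel of `Q′G′²Q′*`: Theorem 3.14 at `U = 1` for the estimate (2.68) on common top blocks -/

section Kernel

variable {ℓ Mh k R : ℕ} {P : Fin (d + 1) → ℕ}

/-- **THE WEIGHTED (2.69)-KERNEL AS A BLOCK AVERAGE**: `W(y′)·X(y, y′) = Σ_x q(y, x)·((G′G′)1_{B(y′)})(x)` — the entry of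
`Q′G′²Q′*` in point masses is the `Q′`-average over `B(y)` of `G′²` applied to the indicator of `B(y′)` (`Q′*δ_{y′} = 1_{B(y′)}`
in the pairing (2.69)). [cite: Balaban1984PropagatorsII, (2.68)–(2.69) p.235] -/
theorem W_mul_XkT_eq (D₀ : TDomains d ℓ Mh k P R) (a : ℕ → ℝ) (y y' : ↥(bset D₀.toDomains)) :
    W D₀.toDomains y' * XkT D₀ a y y'
      = ∑ x, qB D₀.toDomains y x * ((gmlT (N0 ℓ Mh k P) ℓ k D₀.lev a * gmlT (N0 ℓ Mh k P) ℓ k D₀.lev a)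
          *ᵥ (fun z => if blkOf D₀.toDomains z = y' then (1 : ℝ) else 0)) x := by
  classical
  have hW : W D₀.toDomains y' ≠ 0 := (W_pos D₀.toDomains y').ne'
  unfold XkT kernelW
  rw [mul_div_cancel₀ _ hW]
  unfold mat QB
  simp only [LinearMap.comp_apply, Matrix.toLin'_apply, avgOp_apply, Matrix.mulVec_mulVec]
  refine Finset.sum_congr rfl fun x _ => ?_
  congr 2
  funext z
  rw [QsB_apply]
  by_cases hz : blkOf D₀.toDomains z = y'
  · rw [hz, if_pos rfl, Pi.single_eq_same]
  · rw [if_neg hz, Pi.single_eq_of_ne hz]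

/-- on COMMON blocks the averaging data of the two families agree: the indicator of `B(y′)` …
[cite: Balaban1984PropagatorsII, (2.45) p.231, dictionary] -/
theorem indicator_common (D D' : TDomains d ℓ Mh k P R) {q : ℕ × (Fin (d + 1) → ℤ)} (hqD : q ∈ bset D.toDomains)
    (hqD' : q ∈ bset D'.toDomains) :
    (fun z : ↥(boxDom (N0 ℓ Mh k P)) => if blkOf D.toDomains z = ⟨q, hqD⟩ then (1 : ℝ) else 0)
      = fun z => if blkOf D'.toDomains z = ⟨q, hqD'⟩ then (1 : ℝ) else 0 := by
  funext z
  by_cases hz : blkOf D.toDomains z = ⟨q, hqD⟩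
  · rw [if_pos hz, if_pos ((blkOf_eq_iff_blkOf_eq D D' hqD hqD' z).1 hz)]
  · rw [if_neg hz, if_neg (fun h => hz ((blkOf_eq_iff_blkOf_eq D D' hqD hqD' z).2 h))]

/-- … and the block-mean kernel `q(y, ·)`. [cite: Balaban1984PropagatorsII, (2.14) p.225, (2.69) p.235, dictionary] -/
theorem qB_common (D D' : TDomains d ℓ Mh k P R) {p : ℕ × (Fin (d + 1) → ℤ)} (hpD : p ∈ bset D.toDomains)
    (hpD' : p ∈ bset D'.toDomains) (x : ↥(boxDom (N0 ℓ Mh k P))) :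
    qB D.toDomains ⟨p, hpD⟩ x = qB D'.toDomains ⟨p, hpD'⟩ x := by
  unfold qB
  have hW : W D.toDomains ⟨p, hpD⟩ = W D'.toDomains ⟨p, hpD'⟩ := by rw [W_eq, W_eq]
  by_cases hx : blkOf D.toDomains x = ⟨p, hpD⟩
  · rw [if_pos hx, if_pos ((blkOf_eq_iff_blkOf_eq D D' hpD hpD' x).1 hx), hW]
  · rw [if_neg hx, if_neg (fun h => hx ((blkOf_eq_iff_blkOf_eq D D' hpD hpD' x).2 h))]

/-- the (2.69) weights of a common block agree. [cite: Balaban1984PropagatorsII, (2.69) p.235, dictionary] -/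
theorem W_common (D D' : TDomains d ℓ Mh k P R) {q : ℕ × (Fin (d + 1) → ℤ)} (hqD : q ∈ bset D.toDomains)
    (hqD' : q ∈ bset D'.toDomains) : W D.toDomains ⟨q, hqD⟩ = W D'.toDomains ⟨q, hqD'⟩ := by rw [W_eq, W_eq]

/-- **THE DIFFERENCE OF THE WEIGHTED KERNELS ON COMMON BLOCKS IS A BLOCK AVERAGE OF `(G′[D]² − G′[D′]²)1_{B(y′)}`**.
[cite: Balaban1984PropagatorsII, (2.68)–(2.69) p.235; Balaban1985BackgroundPropagators, Thm 3.14 p.427] -/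
theorem W_mul_XkT_sub (D D' : TDomains d ℓ Mh k P R) (a : ℕ → ℝ) {p q : ℕ × (Fin (d + 1) → ℤ)}
    (hpD : p ∈ bset D.toDomains) (hpD' : p ∈ bset D'.toDomains) (hqD : q ∈ bset D.toDomains)
    (hqD' : q ∈ bset D'.toDomains) :
    W D.toDomains ⟨q, hqD⟩ * XkT D a ⟨p, hpD⟩ ⟨q, hqD⟩ - W D'.toDomains ⟨q, hqD'⟩ * XkT D' a ⟨p, hpD'⟩ ⟨q, hqD'⟩
      = ∑ x, qB D.toDomains ⟨p, hpD⟩ x *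
          ((gmlT (N0 ℓ Mh k P) ℓ k D.lev a * gmlT (N0 ℓ Mh k P) ℓ k D.lev a
              - gmlT (N0 ℓ Mh k P) ℓ k D'.lev a * gmlT (N0 ℓ Mh k P) ℓ k D'.lev a)
            *ᵥ (fun z => if blkOf D.toDomains z = ⟨q, hqD⟩ then (1 : ℝ) else 0)) x := by
  rw [W_mul_XkT_eq D a, W_mul_XkT_eq D' a, ← indicator_common D D' hqD hqD', ← Finset.sum_sub_distrib]
  refine Finset.sum_congr rfl fun x _ => ?_
  rw [← qB_common D D' hpD hpD' x, Matrix.sub_mulVec, Pi.sub_apply]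
  ring

/-- **[B9] THEOREM 3.14 AT `U = 1` FOR THE (2.69)-KERNEL OF `Q′G′²Q′*` ON THE GENUINE `k`-LEVEL TORUS — the estimate
(2.68) for the difference.**  There are `δ, C, M₀ > 0`, `N₀ ≥ 1` (functions of `d`, `L` and the weight window) such that for
every `k`, `M_h ≥ 3` with `L·M_h ≥ M₀`, `R ≥ 2L` with `R·L·M_h ≥ N₀ + 1`, `P_μ ≥ 4`, every two nested families `D, D′` of the
torus, windowed weights and every two blocks `y, y′` at the top level in BOTH families («the points y, y′ ∈ Ω^{(k)}»,
`Ω = Ω_k ∩ Ω′_k`), with `X[D] = XkT D a` the (2.69)-kernel of `Q′G′[D]²Q′*`: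
`|(L^k)^{d+1}·(X[D](y, y′) − X[D′](y, y′))| ≤ C·L^{4k}·e^{−δ·min(d_D,d_{D′})(y,y′)}·e^{−δ·d(y,y′,Ω)}` and
`|X[D](y, y′) − X[D′](y, y′)| ≤ C·L^{4k}·((L^k)^{d+1})⁻¹·e^{−δ·min(d_D,d_{D′})(y,y′)}·e^{−δ·d(y,y′,Ω)}` — (2.68)
«|(Q′G′²Q′*)(y, y′)| ≤ O(1)(L^jη)⁴(L^{j′}η)^{−d}e^{−¼δ₀d(y,y′)}» for the difference, «with the additional factor
exp(−δ₀d(y, y′, Ω))». [cite: Balaban1985BackgroundPropagators, Thm 3.14 (3.154) pp.426–427; Balaban1984PropagatorsII, (2.68)–(2.69) p.235] -/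
theorem thm314_X_flat_multiLevelTorus (d ℓ : ℕ) (hℓ : 1 ≤ ℓ) (aminus aplus a2minus a2plus : ℝ) (ha : 0 < aminus)
    (ha2 : 0 < a2minus) :
    ∃ δ C M₀ : ℝ, ∃ N₀ : ℕ, 0 < δ ∧ 0 < C ∧ 0 < M₀ ∧ 0 < N₀ ∧
      ∀ (k Mh R : ℕ), 3 ≤ Mh → M₀ ≤ ((ℓ : ℝ) + 1) * Mh → 2 * (ℓ + 1) ≤ R → N₀ + 1 ≤ R * ((ℓ + 1) * Mh) →
      ∀ (P : Fin (d + 1) → ℕ) (hP : ∀ μ, 1 ≤ P μ) (hP4 : ∀ μ, 4 ≤ P μ) (D D' : TDomains d ℓ Mh k P R)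
        (a c : ℕ → ℝ), (∀ i, 1 ≤ i → aminus ≤ a i ∧ a i ≤ aplus) → (∀ i, 1 ≤ i → a2minus ≤ c i ∧ c i ≤ a2plus) →
        (∀ i, 1 ≤ i → a (i + 1) = aNext ℓ (a i) (c i)) →
      ∀ (p q : ℕ × (Fin (d + 1) → ℤ)) (hpD : p ∈ bset D.toDomains) (hpD' : p ∈ bset D'.toDomains)
        (hqD : q ∈ bset D.toDomains) (hqD' : q ∈ bset D'.toDomains), p.1 = k → q.1 = k →
        |W D.toDomains ⟨q, hqD⟩ * XkT D a ⟨p, hpD⟩ ⟨q, hqD⟩ - W D'.toDomains ⟨q, hqD'⟩ * XkT D' a ⟨p, hpD'⟩ ⟨q, hqD'⟩|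
            ≤ C * ((ℓ : ℝ) + 1) ^ (4 * k)
              * Real.exp (-(δ * min ((geomT D).dist ⟨p, hpD⟩ ⟨q, hqD⟩) ((geomT D').dist ⟨p, hpD'⟩ ⟨q, hqD'⟩)))
              * Real.exp (-(δ * dOmega D D' p.2 q.2)) ∧
        |XkT D a ⟨p, hpD⟩ ⟨q, hqD⟩ - XkT D' a ⟨p, hpD'⟩ ⟨q, hqD'⟩|
            ≤ C * ((ℓ : ℝ) + 1) ^ (4 * k) * ((((ℓ : ℝ) + 1) ^ k) ^ (d + 1))⁻¹
              * Real.exp (-(δ * min ((geomT D).dist ⟨p, hpD⟩ ⟨q, hqD⟩) ((geomT D').dist ⟨p, hpD'⟩ ⟨q, hqD'⟩)))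
              * Real.exp (-(δ * dOmega D D' p.2 q.2)) := by
  obtain ⟨δ, C, M₀, N₀, hδ, hC, hM₀, hN₀, h⟩ := thm314_GpSq_flat_multiLevelTorus d ℓ hℓ aminus aplus a2minus a2plus ha ha2
  refine ⟨δ, C, M₀, N₀, hδ, hC, hM₀, hN₀, ?_⟩
  intro k Mh R hMh hM hR hRM P hP hP4 D D' a c haw hcw hac p q hpD hpD' hqD hqD' hp hq
  have hind : BlockSupp (g := geomT D) (blkOf D.toDomains)
      (fun z : ↥(boxDom (N0 ℓ Mh k P)) => if blkOf D.toDomains z = ⟨q, hqD⟩ then (1 : ℝ) else 0) ⟨q, hqD⟩ 1 :=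
    ⟨zero_le_one, fun z hz => by simp [hz], fun z hz => if_neg hz⟩
  have hpt := fun x (hx : blkOf D.toDomains x = ⟨p, hpD⟩) =>
    h k Mh R hMh hM hR hRM P hP hP4 D D' a c haw hcw hac p q hpD hpD' hqD hqD' hp hq _ 1 hind x hx
  set Kc : ℝ := C * ((ℓ : ℝ) + 1) ^ (4 * k)
      * Real.exp (-(δ * min ((geomT D).dist ⟨p, hpD⟩ ⟨q, hqD⟩) ((geomT D').dist ⟨p, hpD'⟩ ⟨q, hqD'⟩)))
      * Real.exp (-(δ * dOmega D D' p.2 q.2)) with hKc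
  have hKc0 : 0 ≤ Kc := by rw [hKc]; positivity
  have hfirst : |W D.toDomains ⟨q, hqD⟩ * XkT D a ⟨p, hpD⟩ ⟨q, hqD⟩
      - W D'.toDomains ⟨q, hqD'⟩ * XkT D' a ⟨p, hpD'⟩ ⟨q, hqD'⟩| ≤ Kc := by
    rw [W_mul_XkT_sub D D' a hpD hpD' hqD hqD']
    refine (Finset.abs_sum_le_sum_abs _ _).trans ?_
    have hterm : ∀ x, |qB D.toDomains ⟨p, hpD⟩ x *
        ((gmlT (N0 ℓ Mh k P) ℓ k D.lev a * gmlT (N0 ℓ Mh k P) ℓ k D.lev a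
            - gmlT (N0 ℓ Mh k P) ℓ k D'.lev a * gmlT (N0 ℓ Mh k P) ℓ k D'.lev a)
          *ᵥ (fun z => if blkOf D.toDomains z = ⟨q, hqD⟩ then (1 : ℝ) else 0)) x|
        ≤ |qB D.toDomains ⟨p, hpD⟩ x| * Kc := by
      intro x
      rw [abs_mul]
      by_cases hq0 : qB D.toDomains ⟨p, hpD⟩ x = 0
      · rw [hq0, abs_zero, zero_mul, zero_mul]
      · have hx := qB_ne_zero D.toDomains hq0
        have h1 := hpt x hx
        rw [mul_one] at h1
        exact mul_le_mul_of_nonneg_left h1 (abs_nonneg _)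
    calc _ ≤ ∑ x, |qB D.toDomains ⟨p, hpD⟩ x| * Kc := Finset.sum_le_sum fun x _ => hterm x
      _ = (∑ x, |qB D.toDomains ⟨p, hpD⟩ x|) * Kc := by rw [Finset.sum_mul]
      _ ≤ 1 * Kc := mul_le_mul_of_nonneg_right (sum_abs_qB_le D.toDomains ⟨p, hpD⟩) hKc0
      _ = Kc := one_mul _
  refine ⟨hfirst, ?_⟩
  have hWq : W D.toDomains ⟨q, hqD⟩ = (((ℓ : ℝ) + 1) ^ k) ^ (d + 1) := by rw [W_eq]; simp only [hq]
  have hWq' : W D'.toDomains ⟨q, hqD'⟩ = (((ℓ : ℝ) + 1) ^ k) ^ (d + 1) := by rw [W_eq]; simp only [hq]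
  have hWpos : (0 : ℝ) < (((ℓ : ℝ) + 1) ^ k) ^ (d + 1) := by positivity
  rw [hWq, hWq', ← mul_sub, abs_mul, abs_of_pos hWpos] at hfirst
  rw [mul_comm] at hfirst
  have h2 := (le_div_iff₀ hWpos).2 hfirst
  calc _ ≤ Kc / (((ℓ : ℝ) + 1) ^ k) ^ (d + 1) := h2
    _ = _ := by rw [hKc]; ring

end Kernel

end

end Literature.MathematicalPhysics.QuantumFieldTheory.Balaban1983to89.B9Thm314GpSqFlatMultiLevelTorus
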